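import Summits.KontsevichZagierPeriods.KontsevichZagierPeriods.Theorems.IsogenyCertificatesXMapKernelCellsUnconditional

/-!
# Stub-critic probe — `stub_reductionToRealPeriodSector` (K) of crux `XMapKernel` (stmt-KontsevichZagierPeriods-10663)

The registered stub signature, VERBATIM, is closed in both directions against the summit by theorems already
in the tree (no new mathematics). This is the certificate behind the STUB-PLAN's top line
("K is the summit; end `verdict: open-problem`").
-/

namespace Summit.KontsevichZagierPeriods.KontsevichZagierPeriods.Cruxes.XMapKernel.StubCritic

open Literature.NumberTheory.Transcendental
open Summit.KontsevichZagierPeriods.XMapKernel.Negative (gens crux_iff closure_gens_le_ker_eval)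
open Summit.KontsevichZagierPeriods.IsogenyCertificates

/-- The stub, verbatim (registration 3 of `Lines/isogeny_orbit_collapse.lean`, l. 135). -/
def K : Prop :=
  ∀ c : Literature.NumberTheory.Transcendental.KZ.FormalRep, Literature.NumberTheory.Transcendental.KZ.eval c = 0 → ∃ c' ∈ AddSubgroup.closure {d : Literature.NumberTheory.Transcendental.KZ.FormalRep | ∃ (A B : ℤ) (a : ℚ) (r : Literature.NumberTheory.Transcendental.KZ.IntegralRep 1), 4 * A ^ 3 + 27 * B ^ 2 ≠ 0 ∧ r.domain = {x | 0 < x 0 ^ 3 + (A : ℝ) * x 0 + (B : ℝ)} ∧ Set.EqOn r.integrand (fun x => (a : ℝ) / Real.sqrt (x 0 ^ 3 + (A : ℝ) * x 0 + (B : ℝ))) r.domain ∧ d = Literature.NumberTheory.Transcendental.KZ.of r}, c - c' ∈ AddSubgroup.closure Summit.KontsevichZagierPeriods.XMapKernel.Negative.gens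

/-- H1: K ↔ the summit, by name (p119755). -/
theorem K_iff_summit : K ↔ _root_.KontsevichZagierPeriods :=
  XMapKernelCells.reductionToRealPeriodSector_iff_summit_holds

/-- H2: K ↔ the crux, by name (p119755). -/
theorem K_iff_crux :
    K ↔ Summit.KontsevichZagierPeriods.KontsevichZagierPeriods.Theses.IsogenyCertificates.XMapKernel :=
  XMapKernelCells.xMapKernel_iff_reductionToRealPeriodSector.symm

/-- H3: K ↔ the named open conjecture (kernel form of KZ Conjecture 1), by name (p116992). -/
theorem K_iff_kzKernelConjecture : K ↔ KZKernelConjecture :=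
  K_iff_crux.trans XMapKernelIffSummit.xMapKernel_iff_kzKernelConjecture

/-- H4: the `∃ c'` clause is inert — K is `ker eval ≤ closure gens` verbatim (witness `c' := 0`). -/
theorem K_iff_kernel : K ↔ ∀ c : KZ.FormalRep, KZ.eval c = 0 → c ∈ AddSubgroup.closure gens :=
  K_iff_crux.trans crux_iff

/-- H4′: … and `closure gens = KZ.relations`, so K ↔ `ker eval ≤ relations`. -/
theorem K_iff_ker_le_relations : K ↔ ∀ c : KZ.FormalRep, KZ.eval c = 0 → c ∈ KZ.relations := by
  rw [K_iff_kernel, XMapKernelIffSummit.closure_gens_eq_relations_holds]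

/-- The only type-correct assembly of K from anything in the tree: from the summit itself. -/
theorem K_of_summit (h : _root_.KontsevichZagierPeriods) : K := K_iff_summit.mpr h

/-- COSTUME TEST for any proposed helper set `helpers ⇒ K`: composing with this closes the summit, so one
helper is summit-strength. -/
theorem summit_of_K (h : K) : _root_.KontsevichZagierPeriods := K_iff_summit.mp h

#print axioms K_iff_summit
#print axioms K_iff_kzKernelConjecture
#print axioms K_iff_ker_le_relations

end Summit.KontsevichZagierPeriods.KontsevichZagierPeriods.Cruxes.XMapKernel.StubCritic
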